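import Mathlib
import Summits.Ventures.PercRepro.TriangleCapMaxDegStability

/-!
# PercRepro — THE STABILITY OF THE PAIR COUNT ONE LEVEL FURTHER: `Δ ≤ s − 3` (p3, gen 47; part 200zh)

`sum_deg_sq_le_of_maxdeg` of part 200q (`Δ ≤ s − 2`: `Σ d² + 4 (s − 3) ≤ s (s + 1)`) one level further: a
triangle-free graph with `s ≥ 8` edges and every degree `≤ s − 3` has `Σ_v d(v)² + 6 (s − 4) ≤ s (s + 1)` — the same
pair count, with the pairs off a maximum-degree vertex `v₀` avoiding `≥ Δ − 1` edges each, so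
`Σ d² + 2 (s − Δ)(Δ − 1) ≤ s (s + 1)` and `(s − Δ)(Δ − 1) ≥ 3 (s − 4)` for `4 ≤ Δ ≤ s − 3`, while `Δ ≤ 3` gives
`Σ d² ≤ 6s ≤ s (s + 1) − 6 (s − 4)` for `s ≥ 8`; the `(s − 3)`-star plus a `3`-star sharing leaves is extremal
(`Σ d² = s² − 5s + 24`). `closed_form_stability_bipSub_maxdeg3` is the read on the bipartite class — the all-off read
of the cell `r = a + 2`. Axioms: standard.
-/

namespace PercRepro

namespace TriangleCap

namespace C047

open Finset

variable {V : Type*} [Fintype V] [DecidableEq V]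

/-- **THE STABILITY OF THE PAIR COUNT UNDER `Δ ≤ s − 3`:** a triangle-free graph with `s ≥ 8` edges and every degree
`≤ s − 3` has `Σ_v d(v)² + 6 (s − 4) ≤ s (s + 1)` (the `(s − 3)`-star plus a `3`-star sharing leaves is extremal). -/
theorem sum_deg_sq_le_of_maxdeg3 (H : SimpleGraph V) [DecidableRel H.Adj] (hfree : H.CliqueFree 3)
    (hs : 8 ≤ H.edgeFinset.card) (hΔ : ∀ v, deg H v + 3 ≤ H.edgeFinset.card) :
    ∑ v, deg H v * deg H v + 6 * (H.edgeFinset.card - 4) ≤ H.edgeFinset.card * (H.edgeFinset.card + 1) := by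
  have hsum := sum_adjPairsAll_nonIncident_eq H
  rw [sum_adjPairsAll_deg_add] at hsum
  have hne : (univ : Finset V).Nonempty := by
    obtain ⟨e, he⟩ := card_pos.mp (by omega : 0 < H.edgeFinset.card)
    revert he
    refine Sym2.ind (fun x y _ => ⟨x, mem_univ x⟩) e
  obtain ⟨v₀, -, hmax⟩ := exists_max_image univ (fun v => deg H v) hne
  have hoff : (H.edgeFinset.filter (fun e => v₀ ∉ e)).card + deg H v₀ = H.edgeFinset.card := by
    have := card_filter_add_card_filter_not (s := H.edgeFinset) (fun e => v₀ ∉ e)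
    have h2 : H.edgeFinset.filter (fun e => ¬ v₀ ∉ e) = H.incidenceFinset v₀ := by
      ext e
      simp only [mem_filter, SimpleGraph.mem_incidenceFinset, SimpleGraph.mem_edgeFinset, not_not]
      rfl
    rw [h2, ← deg_eq_card_incidenceFinset] at this
    exact this
  rcases Nat.lt_or_ge (deg H v₀) 4 with hΔ2 | hΔ3
  · -- every degree `≤ 3`: `Σ d² ≤ 3 Σ d = 6 s ≤ s (s + 1) − 6 (s − 4)` for `s ≥ 8`
    have hall : ∀ v, deg H v * deg H v ≤ 3 * deg H v := by
      intro v
      have := hmax v (mem_univ v)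
      have : deg H v ≤ 3 := by omega
      interval_cases h : deg H v <;> omega
    have h3 := sum_deg_eq H
    have h4 : ∑ v, deg H v * deg H v ≤ ∑ v, 3 * deg H v := sum_le_sum (fun v _ => hall v)
    rw [← mul_sum, h3] at h4
    obtain ⟨m', hm'⟩ : ∃ m', H.edgeFinset.card = m' + 8 := ⟨H.edgeFinset.card - 8, by omega⟩
    rw [hm'] at h4 ⊢
    have e : m' + 8 - 4 = m' + 4 := by omega
    rw [e]
    nlinarith [h4]
  · -- `Σ nonIncident ≥ 4 s′ (Δ − 1)`, `s′ = s − Δ ≥ 3`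
    have hsplit := sum_filter_add_sum_filter_not (adjPairsAll H) (fun p : V × V => p.1 ≠ v₀ ∧ p.2 ≠ v₀)
      (fun p => nonIncident H p.1 p.2)
    have hP1 : ((adjPairsAll H).filter (fun p : V × V => p.1 ≠ v₀ ∧ p.2 ≠ v₀)).card * (deg H v₀ - 1) ≤
        ∑ p ∈ (adjPairsAll H).filter (fun p : V × V => p.1 ≠ v₀ ∧ p.2 ≠ v₀), nonIncident H p.1 p.2 := by
      rw [← smul_eq_mul, ← sum_const]
      apply sum_le_sum
      intro p hp
      rw [mem_filter, mem_adjPairsAll] at hp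
      have := nonIncident_ge_of_off H hfree v₀ hp.1 hp.2.1 hp.2.2
      omega
    have hP2 := sum_nonIncident_at_eq H v₀
    have hP2' := sum_nonIncident_at_ge H hfree v₀
    have hcard := card_adjPairs_off_vertex H v₀
    set s' := (H.edgeFinset.filter (fun e => v₀ ∉ e)).card with hs'
    set Δ := deg H v₀ with hΔ'
    have hΔs := hΔ v₀
    clear_value s' Δ
    -- the arithmetic: `(s′)(Δ − 1) ≥ 3 (s − 4)` for `4 ≤ Δ ≤ s − 3`, `s′ = s − Δ`
    have key : 3 * (H.edgeFinset.card - 4) ≤ s' * (Δ - 1) := by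
      obtain ⟨d, rfl⟩ : ∃ d, Δ = d + 4 := ⟨Δ - 4, by omega⟩
      obtain ⟨t, rfl⟩ : ∃ t, s' = t + 3 := ⟨s' - 3, by omega⟩
      have : H.edgeFinset.card = t + d + 7 := by omega
      rw [this]
      have e1 : t + d + 7 - 4 = t + d + 3 := by omega
      have e2 : d + 4 - 1 = d + 3 := by omega
      rw [e1, e2]
      nlinarith [Nat.zero_le (t * d)]
    rw [← hsplit] at hsum
    have hP1' : 2 * s' * (Δ - 1) ≤
        ∑ p ∈ (adjPairsAll H).filter (fun p : V × V => p.1 ≠ v₀ ∧ p.2 ≠ v₀), nonIncident H p.1 p.2 := by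
      have : ((adjPairsAll H).filter (fun p : V × V => p.1 ≠ v₀ ∧ p.2 ≠ v₀)).card = 2 * s' := by omega
      rw [this] at hP1
      exact hP1
    nlinarith [hsum, hP1', hP2, hP2', key]

/-- **THE STABILITY ON THE BIPARTITE CLASS UNDER `Δ ≤ s − 3`:** a spanning subgraph of `K(A, Aᶜ)`, `|A| = a`,
with `s ≥ 8` missing cross pairs (`s + 1 ≤ k`), no vertex missing more than `s − 3` of them, has
`Σ_v d(v)² + s (k − 1 − s) + 6 (s − 4) ≤ m k`. -/
theorem closed_form_stability_bipSub_maxdeg3 (D : SimpleGraph V) [DecidableRel D.Adj] (A : Finset V)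
    (hD : BipSub D A) (a s : ℕ) (hA : A.card = a) (hm : D.edgeFinset.card + s = a * (Fintype.card V - a))
    (hs1 : s + 1 ≤ Fintype.card V) (hs4 : 8 ≤ s) (hmax : ∀ v, deg (missingGraph D A) v + 3 ≤ s) :
    ∑ v, deg D v * deg D v + s * (Fintype.card V - 1 - s) + 6 * (s - 4) ≤
      D.edgeFinset.card * Fintype.card V := by
  have key := sum_deg_sq_bipSub D A hD
  have hM := card_edges_missingGraph D A hD a s hA hm
  rw [hM, hA] at key
  have hfree := cliqueFree_of_bipSub (missingGraph D A) A (bipSub_missingGraph D A)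
  have hstab := sum_deg_sq_le_of_maxdeg3 (missingGraph D A) hfree (by rw [hM]; exact hs4)
    (fun v => by rw [hM]; exact hmax v)
  rw [hM] at hstab
  obtain ⟨t, ht⟩ : ∃ t, Fintype.card V = s + 1 + t := ⟨_, (Nat.add_sub_cancel' hs1).symm⟩
  have e : s + 1 + t - 1 - s = t := by omega
  rw [ht, e]
  rw [ht] at key hm
  obtain ⟨s', rfl⟩ : ∃ s', s = s' + 8 := ⟨s - 8, by omega⟩
  have e2 : s' + 8 - 4 = s' + 4 := by omega
  rw [e2] at hstab ⊢
  generalize hS : ∑ v, deg D v * deg D v = S at key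
  generalize hH : ∑ v, deg (missingGraph D A) v * deg (missingGraph D A) v = H at key hstab
  generalize hM' : D.edgeFinset.card = M at key hm
  generalize hP : a * (s' + 8 + 1 + t - a) = P at key hm
  nlinarith [key, hm, hstab]

end C047

end TriangleCap

end PercRepro
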